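import Mathlib

/-!
# TRIAGE r1 seat 1 (gen 12) — kernel check behind the (H.2) computation of `TRIAGE-r1-1.md` gen-11 §2

crux stmt-BirchSwinnertonDyer-19875 `SprungLowerDivisibilityAtThree`; seat refuter-cruxtriage-…-r1-1 (g12, 2026-08-28).
Evidence only: NO idea verdict changes; BSD / K1 / the X8 leaf are NOT proved by anything here.
Mathlib-only; `decide +kernel` over the 81 matrices of M₂(𝔽₃) (same hand-rolled encoding as
`TriageR11GL2F3.lean`, re-declared in a fresh sub-namespace so that this file is self-contained).

CLAIM MADE KERNEL-LEVEL (gen-11 §2, pricing of `kurihara-digit`'s lane and of the ¬Surj complement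
`dihedral-elliptic-unit-anchor` / stub S5): on an X8 cell with NON-surjective mod-3 image the image is
N(C_ns(3)) (gen-3 file), so ρ̄(G_{ℚ(μ₃)}) = N(C_ns(3)) ∩ SL₂(𝔽₃); this intersection is a quaternion group
Q₈ = {±I} ∪ {6 elements of order 4}, and for EVERY element τ̄ of it, τ̄ − I is either 0 or INVERTIBLE.
Hence no τ ∈ G_{ℚ(μ_{3^m})} has T/(τ − 1)T free of rank one over ℤ/3^m (Mazur–Rubin / Sakamoto 2024
hypothesis (H.2)): if τ̄ = I then τ − 1 ∈ 3·M₂(ℤ₃) and coker(τ − 1) ↠ 𝔽₃² is not cyclic; otherwise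
τ − 1 ∈ GL₂(ℤ₃) and the cokernel is 0 (two lines of paper on top of the theorems below).
CONTRAST (Surj / TowerSurj cells): the transvection t = [[1,1],[0,1]] ∈ SL₂ has t − I ≠ 0 of determinant 0,
i.e. coker(t − I) is a LINE — the Kolyvagin element exists.
-/

set_option autoImplicit false
set_option linter.dupNamespace false

namespace Summit.BirchSwinnertonDyer.BirchSwinnertonDyer.Cruxes.SprungLowerDivisibilityAtThree.TriageR11

namespace KolyvaginTau

abbrev M := ZMod 3 × ZMod 3 × ZMod 3 × ZMod 3

/-- matrix product of `!![x₁,x₂;x₃,x₄] * !![y₁,y₂;y₃,y₄]` -/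
def mul (x y : M) : M :=
  (x.1 * y.1 + x.2.1 * y.2.2.1, x.1 * y.2.1 + x.2.1 * y.2.2.2,
   x.2.2.1 * y.1 + x.2.2.2 * y.2.2.1, x.2.2.1 * y.2.1 + x.2.2.2 * y.2.2.2)

/-- entrywise difference -/
def sub (x y : M) : M := (x.1 - y.1, x.2.1 - y.2.1, x.2.2.1 - y.2.2.1, x.2.2.2 - y.2.2.2)

def one : M := (1, 0, 0, 1)
def negOne : M := (-1, 0, 0, -1)
def zero : M := (0, 0, 0, 0)
def det (x : M) : ZMod 3 := x.1 * x.2.2.2 - x.2.1 * x.2.2.1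

def pw (x : M) : ℕ → M
  | 0 => one
  | n + 1 => mul (pw x n) x

/-- `g` has order exactly 8 (a generator of a non-split Cartan C_ns(3) ≅ 𝔽₉ˣ). -/
def ord8 (g : M) : Bool := decide (pw g 8 = one ∧ pw g 4 ≠ one)

/-- `x` is invertible and normalises `⟨g⟩`. -/
def normalises (g x : M) : Bool :=
  decide (det x ≠ 0 ∧ (mul x g = mul g x ∨ mul x g = mul (pw g 3) x ∨
    mul x g = mul (pw g 5) x ∨ mul x g = mul (pw g 7) x))

/-- `x ∈ N(⟨g⟩) ∩ SL₂(𝔽₃)` = the image of `G_{ℚ(μ₃)}` when `im ρ̄ = N(⟨g⟩)`. -/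
def inNSL (g x : M) : Bool := normalises g x && decide (det x = 1)

/-- sanity (agrees with `TriageR11GL2F3.normaliser_card`): |N(⟨g⟩)| = 16. -/
theorem normaliser_card : ∀ g : M, ord8 g →
    (Finset.univ.filter fun x : M => normalises g x = true).card = 16 := by decide +kernel

/-- Fact H2-a: N(C_ns(3)) ∩ SL₂(𝔽₃) has exactly 8 elements. -/
theorem nsl_card : ∀ g : M, ord8 g →
    (Finset.univ.filter fun x : M => inNSL g x = true).card = 8 := by decide +kernel

/-- Fact H2-b: it is a quaternion group Q₈: every element is I, −I, or squares to −I (order 4);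
    and exactly 6 elements have order 4. -/
theorem nsl_structure : ∀ g : M, ord8 g → ∀ x : M, inNSL g x = true →
    x = one ∨ x = negOne ∨ mul x x = negOne := by decide +kernel

theorem nsl_count_ord4 : ∀ g : M, ord8 g →
    (Finset.univ.filter fun x : M => inNSL g x = true ∧ mul x x = negOne).card = 6 := by decide +kernel

/-- Fact H2-c (the obstruction): for every τ̄ ∈ N(C_ns(3)) ∩ SL₂(𝔽₃), τ̄ − I is 0 or invertible —
    so coker(τ̄ − I) on 𝔽₃² is never a line. -/
theorem nsl_sub_one_zero_or_unit : ∀ g : M, ord8 g → ∀ x : M, inNSL g x = true →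
    sub x one = zero ∨ det (sub x one) ≠ 0 := by decide +kernel

/-- the same, phrased as: no element of N(C_ns(3)) ∩ SL₂(𝔽₃) has τ̄ − I of rank exactly one. -/
theorem nsl_no_rank_one : ∀ g : M, ord8 g → ∀ x : M, inNSL g x = true →
    ¬ (sub x one ≠ zero ∧ det (sub x one) = 0) := by decide +kernel

/-- Fact H2-d (for comparison, the whole normaliser, det = −1 allowed): the elements of N(C_ns(3)) with
    τ̄ − I of rank one are exactly the 4 involutions of determinant −1 outside C₈ (reflections) — they are
    NOT in the image of G_{ℚ(μ₃)} (det = cyclotomic character must be 1 there). -/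
theorem normaliser_rank_one_are_odd_involutions : ∀ g : M, ord8 g → ∀ x : M, normalises g x = true →
    sub x one = zero ∨ det (sub x one) ≠ 0 ∨ (det x = -1 ∧ mul x x = one) := by decide +kernel
-- (phrased disjunctively: `(τ̄−I ≠ 0 ∧ det(τ̄−I) = 0) → (det τ̄ = −1 ∧ τ̄² = I)`; the nested-implication
--  phrasing of the same statement exceeds the default instance-synthesis budget for `Decidable`.)

theorem normaliser_rank_one_count : ∀ g : M, ord8 g →
    (Finset.univ.filter fun x : M => normalises g x = true ∧ sub x one ≠ zero ∧ det (sub x one) = 0).card = 4 := by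
  decide +kernel

/-- CONTRAST (Surj cells): the transvection lies in SL₂(𝔽₃) and τ̄ − I has rank one. -/
def transvection : M := (1, 1, 0, 1)

theorem transvection_kolyvagin :
    det transvection = 1 ∧ sub transvection one ≠ zero ∧ det (sub transvection one) = 0 := by decide +kernel

/-- and SL₂(𝔽₃) contains exactly 8 such elements with τ̄ − I of rank one (the non-trivial transvections,
    4 of each unipotent sign class … all conjugate to t or t⁻¹ = t²). -/
theorem sl2_rank_one_count :
    (Finset.univ.filter fun x : M => det x = 1 ∧ sub x one ≠ zero ∧ det (sub x one) = 0).card = 8 := by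
  decide +kernel

/-!
Paper glue (TRIAGE-r1-1.md gen-12 addendum): on an X8 ∧ ¬Surj(3) cell im ρ̄ = N(C_ns(3)) (gen-3 file +
3 lines of Lagrange), det ρ̄ = ω, so ρ̄(G_{ℚ(μ_{3^m})}) ⊆ ρ̄(G_{ℚ(μ₃)}) = N ∩ SL₂ ≅ Q₈ (Facts H2-a/b).
For τ in that group: τ̄ = I ⇒ τ − 1 ≡ 0 (mod 3) ⇒ T/(τ−1)T ↠ T/3T ≅ 𝔽₃² needs two generators;
τ̄ ≠ I ⇒ det(τ̄ − I) ≠ 0 (Fact H2-c) ⇒ τ − 1 ∈ GL₂(ℤ₃) ⇒ T/(τ−1)T = 0. Either way T/(τ−1)T is not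
free of rank one over ℤ/3^m for any m ≥ 1: hypothesis (H.2) of [Sakamoto 2024, §2] / [Mazur–Rubin 2004,
§3.5] FAILS on all 61 ¬Surj census cells at every level, while on TowerSurj cells the transvection
(CONTRAST) supplies τ. No verdict changes; this is the kernel form of gen-11 §2's pricing.
-/

end KolyvaginTau

end Summit.BirchSwinnertonDyer.BirchSwinnertonDyer.Cruxes.SprungLowerDivisibilityAtThree.TriageR11
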